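import Mathlib.MeasureTheory.Measure.Regular
import Mathlib.MeasureTheory.Integral.Bochner.Basic
import Mathlib.MeasureTheory.Constructions.BorelSpace.Basic
import Mathlib.Analysis.InnerProductSpace.PiL2
import Mathlib.MeasureTheory.Measure.Haar.InnerProductSpace
import Mathlib.Geometry.Manifold.IntegralCurve.Basic
import Literature.Geometry.Lorentzian.GeodesicFlow
import Literature.Geometry.Lorentzian.Stationary
import HarnessLib

/-!
# The Einstein–massless Vlasov system with a measure-valued distribution function

Topic `Literature/Geometry/Lorentzian` (item `defn-EinsteinMasslessVlasovMeasure`, wanted by route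
`FinalStateConjecture/BurnettKineticRigidity` for its cruxes `KineticRigidityEMV`,
`LateTimeBurnettCompactness`). A collisionless gas of massless particles — photons, or the effective
matter of a Burnett high-frequency limit of vacuum metrics — on a time-oriented Lorentzian manifold
`(M, g, τ)` is a non-negative measure `μ` on the **future null bundle**
`P⁺ = {(x, v) ∈ TM : g(v,v) = 0, v ≠ 0 future-directed}` (Andréasson 2011, §2: the mass shell
`P_m`, `m = 0`; Andréasson–Fajman–Thaller 2017, (2.1)), invariant under the geodesic flow (the
**Vlasov equation**) and sourcing the Einstein equations through its second moments
`T[μ](Y, Z) = ∫ g(v,Y) g(v,Z) dμ` (the **Einstein–massless Vlasov system**). Following Huneau–Luk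
(Def. 2.1, 2.3; arXiv:2403.03470, Thm. 1.5) both equations are imposed on a Radon MEASURE `μ`
weakly — the form in which Burnett limits of vacuum spacetimes are Einstein–massless Vlasov; smooth
densities `f dμ_{P⁺}` are the special case of Huneau–Luk, Prop. 2.2.

## Contents

* `TimeOrientation.futureNullBundle τ` — `P⁺ ⊂ TM`;
* `geodesicDeriv cov a p` — the Liouville operator `X a (p) = d/dt|₀ a(γ(t), γ'(t))` along the
  geodesic of `cov` with initial data `p` (O'Neill 1983, Ch. 3, Prop. 28: the geodesic flow field
  `G` on `TM`), independent of the geodesic germ (`geodesicDeriv_eq_deriv`, proved);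
* `IsTestObservable`, `IsTestVectorField`, `IsInvariantUnderLiftedFlow K μ` (the lifted flow `dφₜ`
  of `K` preserves `μ`);
* `LorentzianMetric.IsMasslessVlasovMeasure g τ μ` (Huneau–Luk, Def. 2.1) — `μ` Radon on `TM`,
  carried by `P⁺`, `∫ X a dμ = 0` for all test observables;
  `LorentzianMetric.IsStationaryVlasovMeasure`;
* `PseudoRiemannianMetric.chartGram`, `PseudoRiemannianMetric.IsVolumeMeasure g vol` — the volume
  measure `√|det g_{ij}| dy` of a pseudo-Riemannian metric (O'Neill 1983, Ch. 7, Lemma 19),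
  characterised chartwise on the model `EuclideanSpace ℝ (Fin m)` (cf. the Riemannian
  `riemannianMeasure_eq_integral_sqrt_det` of `Volume.lean`);
* `LorentzianMetric.IsEinsteinMasslessVlasov g τ vol μ` (Huneau–Luk, Def. 2.3) —
  `∫ Ric(Y,Y) dvol_g = ∫ g(v,Y)² dμ` for test vector fields `Y`, plus the Vlasov equation;
* `Spacetime.EinsteinMasslessVlasov 𝓢` — bundled form (fields `vol`, `measure`), `IsStationary`,
  `IsVacuum`, `IsVacuum.integral_ricci_eq_zero`.

## Design choices

* **`TM`, not `T*M`.** Huneau–Luk use the cotangent bundle and the Hamiltonian `g⁻¹(ξ,ξ)`; `♭`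
  conjugates the co-geodesic flow to the geodesic flow on `TM`, where the tree's geodesic theory
  (`IsGeodesicOn`, `tangentLift`, `GeodesicFlow.lean`) and Andréasson's `P_m ⊂ TM` live; the pairing
  `⟨ξ, Y⟩` becomes `g(v, Y)`.
* **Future half.** The kinetic mass shell is future-directed (Andréasson 2011, §2); Huneau–Luk allow
  the whole null cone. Nothing is lost for the coupling: `v ↦ -v` conjugates the geodesic flow with
  time reversal and fixes `g(v,Y)²`, so the past part of a solution can be reflected onto `P⁺`.
* **Transport, weakly.** Null geodesics are in general incomplete, so flow invariance is stated
  infinitesimally, `∫ X a dμ = 0`, exactly as Huneau–Luk's `∫ {g⁻¹(ξ,ξ), a} dμ = 0`, with smooth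
  compactly supported test observables supported off the zero section (their
  `a ∈ C_c^∞(T*M ∖ {0})`). `X` is defined through geodesic germs (junk `0` without one) rather than
  as a vector field on `TM`, which the tree lacks; the value does not depend on the germ.
* **Integrability is part of the equations**, so that Lean's junk `∫ = 0` of a non-integrable
  function cannot satisfy them vacuously (automatic in the sources: finite measures).
* **The volume measure** `dvol_g` on the Einstein side does not exist in the tree for indefinite
  metrics (`Volume.lean` is Riemannian). It enters as a datum `vol` pinned down by the chart formula
  `IsVolumeMeasure`; existence (consistency of `√|det g_{ij}| dy` under chart changes) is not needed
  to state the equations. Hence the coupling is given for manifolds modelled on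
  `EuclideanSpace ℝ (Fin m)` (all spacetimes of the tree).
* **Regularity** is recorded by fields `one_le : 1 ≤ n` (Vlasov; Huneau–Luk Def. 2.1: `g ∈ C¹`) and
  `two_le : 2 ≤ n` (Einstein; Def. 2.3: `g ∈ C²`) rather than by `Fact` instances.
* **Units.** `Ric = T[μ]` with `8π` absorbed into `μ` (Huneau–Luk). As `μ` lives on null vectors,
  `T[μ]` is trace-free, `R = 0`, and `Ric = T[μ]` is the full equation `Ric − ½ R g = T[μ]`. With
  Andréasson's `G_{ab} = 8π T_{ab}`, `T_{ab} = ∫ f p_a p_b dμ_x`: `μ = 8π f dμ_{P} dvol_g`.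
* σ-algebras are instance hypotheses (Borel intended; `[BorelSpace]` on the bundled structure).

## Deliberately not here

* Metrics below `C²` (Lipschitz Burnett limits, thin null-dust shells): Huneau–Luk define measure
  solutions only for `g ∈ C²` (`C¹` for the Vlasov part) — `∫ ∂g·ξξ·∂_ξ a dμ` has no meaning for a
  singular `μ` when `∂g` is merely `L^∞` — and no published definition covers that case.
* The smooth-density dictionary `μ = f dμ_{P⁺} dvol_g` (fibre measure `√|g| d³p/(-p₀)`,
  Andréasson 2011, §2), the static spherically symmetric photon shells of Andréasson 2021 and
  Andréasson–Fajman–Thaller 2017 (a reduced ODE system), Huneau–Luk's radially-averaged variant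
  (Def. 2.4; equivalent under global hyperbolicity, Lemma 2.5) and "non-radiating" (Bondi side).

## References

* C. Huneau, J. Luk, *Trilinear compensated compactness and Burnett's conjecture in general
  relativity*, Ann. Sci. ÉNS (2024), arXiv:1907.10743, Def. 2.1, Prop. 2.2, Def. 2.3, Def. 2.4,
  Lemma 2.5 (key `HuneauLuk2024trilinear`); *Burnett's conjecture in generalized wave coordinates*,
  arXiv:2403.03470, Assumptions 1.2, Def. 1.4, Thm. 1.5 (key `HuneauLuk2024wave`).
* H. Andréasson, *The Einstein–Vlasov system/kinetic theory*, Living Rev. Relativ. 14 (2011) 4, §2,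
  §5 (key `Andreasson2011`); H. Andréasson, D. Fajman, M. Thaller, Ann. Henri Poincaré 18 (2017),
  arXiv:1511.01290, (2.1) (key `AndreassonFajmanThaller2015`).
* B. O'Neill, *Semi-Riemannian geometry*, 1983, Ch. 3, Lemma 22–23, Prop. 28; Ch. 7, Lemma 19.
-/

noncomputable section

open Bundle Set Filter MeasureTheory Manifold TopologicalSpace
open scoped Manifold ContDiff Topology ENNReal

namespace Literature.Geometry.Lorentzian

universe u

variable {E : Type u} [NormedAddCommGroup E] [NormedSpace ℝ E] {H : Type*} [TopologicalSpace H]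
  {I : ModelWithCorners ℝ E H} {M : Type*} [TopologicalSpace M] [ChartedSpace H M]
  [IsManifold I ∞ M] {n : ℕ∞ω}

/-! ### The future null bundle -/

namespace TimeOrientation

variable {g : LorentzianMetric I n M} (τ : TimeOrientation g)

/-- The **future null bundle** (mass shell of massless particles) `P⁺ ⊂ TM` of a time-oriented
Lorentzian manifold: the tangent vectors `(x, v)` with `v` null (`g(v,v) = 0`, `v ≠ 0`) and
future-directed. Andréasson 2011, §2 (the mass shell `P_m`, `m = 0`); Andréasson–Fajman–Thaller
2017, (2.1): `𝒫 = {(x,p) ∈ TM : g(p,p) = 0, p future directed, p ≠ 0}`.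
[cite: AndreassonFajmanThaller2015, §2 eq. (2.1)] -/
def futureNullBundle : Set (TangentBundle I M) :=
  {p | g.IsNull p.snd ∧ τ.IsFutureDirected p.snd}

/-- Membership in the future null bundle. [folklore] -/
@[simp]
lemma mem_futureNullBundle_iff (p : TangentBundle I M) :
    p ∈ τ.futureNullBundle ↔ g.IsNull p.snd ∧ τ.IsFutureDirected p.snd := Iff.rfl

/-- `(x, v) ∈ P⁺` iff `g(v, v) = 0` and `v` is future-directed (future-directed vectors are causal,
hence non-zero). [folklore] -/
lemma mem_futureNullBundle_iff' (p : TangentBundle I M) :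
    p ∈ τ.futureNullBundle ↔ g.val p.proj p.snd p.snd = 0 ∧ τ.IsFutureDirected p.snd :=
  ⟨fun h ↦ ⟨h.1.1, h.2⟩, fun h ↦ ⟨⟨h.1, h.2.1.2⟩, h.2⟩⟩

/-- The future null bundle does not meet the zero section. [folklore] -/
lemma snd_ne_zero_of_mem_futureNullBundle {p : TangentBundle I M} (hp : p ∈ τ.futureNullBundle) :
    p.snd ≠ 0 := hp.1.2

end TimeOrientation

/-! ### The Liouville operator: differentiation along the geodesic flow -/

section GeodesicDeriv

variable [FiniteDimensional ℝ E] (cov : CovariantDerivative I E (TangentSpace I : M → Type _))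

/-- The **Liouville (geodesic-spray) operator** applied to an observable `a : TM → ℝ` at
`p = (x, v) ∈ TM`: the derivative `d/dt|_{t=0} a(γ(t), γ'(t))` of `a` along the tangent lift of a
geodesic `γ` of `cov` with initial data `(γ(0), γ'(0)) = p` — any geodesic germ gives the same
value (`geodesicDeriv_eq_deriv`); junk value `0` if there is no geodesic germ through `p`, which
does not happen for `C¹` connections on manifolds without boundary. This is O'Neill's geodesic flow
field `G` on `TM` ("`G_v` = the initial velocity of the curve `s ↦ γ'_v(s)` in `TM`", Ch. 3,
Prop. 28) applied to `a`; in induced coordinates `X = vⁱ ∂_{xⁱ} − Γⁱⱼₖ vʲ vᵏ ∂_{vⁱ}`, and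
`X f = 0` is the Vlasov equation `d/ds f(x(s), p(s)) = 0` (Andréasson 2011, §2).
[cite: ONeill1983, Ch. 3, Prop. 28] -/
def geodesicDeriv (a : TangentBundle I M → ℝ) (p : TangentBundle I M) : ℝ :=
  open Classical in
  if h : ∃ γ : ℝ → M, tangentLift I γ 0 = p ∧ ∃ ε : ℝ, 0 < ε ∧ IsGeodesicOn cov γ (Ioo (-ε) ε)
  then deriv (fun t ↦ a (tangentLift I (Classical.choose h) t)) 0 else 0

variable {cov}

/-- **The Liouville operator is well defined**: for a `C¹` connection on a Hausdorff manifold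
without boundary, `geodesicDeriv cov a p` is the derivative at `0` of `a` along the tangent lift of
ANY geodesic germ with initial data `p` (uniqueness of geodesics, O'Neill 1983, Ch. 3, Lemma 23,
through the tree's `IsGeodesicOn.tangentLift_eq`). [cite: ONeill1983, Ch. 3, Lemma 23] -/
theorem geodesicDeriv_eq_deriv [CompleteSpace E] [T2Space M] [BoundarylessManifold I M]
    [CovariantDerivative.ContMDiffCovariantDerivative cov 1] (a : TangentBundle I M → ℝ)
    {p : TangentBundle I M} {γ : ℝ → M} {ε : ℝ} (hε : 0 < ε)
    (hγ : IsGeodesicOn cov γ (Ioo (-ε) ε)) (h0 : tangentLift I γ 0 = p) :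
    geodesicDeriv cov a p = deriv (fun t ↦ a (tangentLift I γ t)) 0 := by
  classical
  have hex : ∃ γ : ℝ → M, tangentLift I γ 0 = p ∧
      ∃ ε : ℝ, 0 < ε ∧ IsGeodesicOn cov γ (Ioo (-ε) ε) := ⟨γ, h0, ε, hε, hγ⟩
  rw [geodesicDeriv, dif_pos hex]
  obtain ⟨h0', ε', hε', hγ'⟩ := Classical.choose_spec hex
  apply Filter.EventuallyEq.deriv_eq
  have hδ : 0 < min ε ε' := lt_min hε hε'
  have hsub : Ioo (-min ε ε') (min ε ε') ⊆ Ioo (-ε) ε :=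
    Ioo_subset_Ioo (neg_le_neg (min_le_left _ _)) (min_le_left _ _)
  have hsub' : Ioo (-min ε ε') (min ε ε') ⊆ Ioo (-ε') ε' :=
    Ioo_subset_Ioo (neg_le_neg (min_le_right _ _)) (min_le_right _ _)
  filter_upwards [Ioo_mem_nhds (show -min ε ε' < 0 by linarith) hδ] with t ht
  have key := IsGeodesicOn.tangentLift_eq (cov := cov) isOpen_Ioo ordConnected_Ioo
    (hγ'.mono hsub') (hγ.mono hsub) (t₀ := 0) ⟨by linarith, hδ⟩ (by rw [h0', h0]) ht
  simp only [key]

/-- The Liouville operator kills constants. [folklore] -/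
@[simp]
lemma geodesicDeriv_const (c : ℝ) (p : TangentBundle I M) :
    geodesicDeriv cov (fun _ ↦ c) p = 0 := by
  unfold geodesicDeriv
  split_ifs <;> simp

end GeodesicDeriv

/-! ### Test observables, test vector fields, lifted flows -/

section Test

variable (I M) in
/-- **Test observables** on the tangent bundle: smooth functions `a : TM → ℝ` with compact support
disjoint from the zero section (Huneau–Luk's `a ∈ C_c^∞(T*M ∖ {0})`, Def. 2.1).
[cite: HuneauLuk2024trilinear, Def. 2.1] -/
def IsTestObservable (a : TangentBundle I M → ℝ) : Prop :=
  ContMDiff I.tangent 𝓘(ℝ, ℝ) ∞ a ∧ HasCompactSupport a ∧ ∀ p ∈ tsupport a, p.snd ≠ 0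

/-- **Test vector fields**: smooth sections `Y` of `TM` vanishing outside a compact set
(Huneau–Luk, Def. 2.3: "for every smooth and compactly supported vector field `Y`").
[cite: HuneauLuk2024trilinear, Def. 2.3] -/
def IsTestVectorField (Y : Π x : M, TangentSpace I x) : Prop :=
  ContMDiff I I.tangent ∞ (fun x ↦ (TotalSpace.mk' E x (Y x) : TangentBundle I M)) ∧
    ∃ K : Set M, IsCompact K ∧ ∀ x, x ∉ K → Y x = 0

/-- The zero section is a test vector field. [folklore] -/
lemma isTestVectorField_zero : IsTestVectorField (I := I) (fun _ : M ↦ (0 : E)) :=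
  ⟨contMDiff_zeroSection ℝ (TangentSpace I : M → Type _), ∅, isCompact_empty, fun _ _ ↦ rfl⟩

/-- The measure `μ` on `TM` is **invariant under the lifted flow** of the vector field `K` on `M`:
`K` has a global flow `φ : ℝ × M → M` (`φ₀ = id`, `t ↦ φₜ(x)` is an integral curve of `K` — so `K`
is complete — and each `φₜ` is `C¹`), and the tangent maps `dφₜ : TM → TM` (Mathlib's
`tangentMap`) push `μ` forward to itself for every `t`. For `μ = f dμ_{P⁺}` and `K` Killing this
says that `f` is invariant under the one-parameter group of isometries generated by `K`.
[folklore] -/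
def IsInvariantUnderLiftedFlow [MeasurableSpace (TangentBundle I M)]
    (K : Π x : M, TangentSpace I x) (μ : Measure (TangentBundle I M)) : Prop :=
  ∃ φ : ℝ → M → M, (∀ x, φ 0 x = x) ∧ (∀ x, IsMIntegralCurve (fun t ↦ φ t x) K) ∧
    (∀ t, ContMDiff I I 1 (φ t)) ∧ ∀ t, Measure.map (tangentMap I I (φ t)) μ = μ

omit [IsManifold I ∞ M] in
/-- Every measure on `TM` is invariant under the (trivial) lifted flow of the zero vector field.
[folklore] -/
lemma isInvariantUnderLiftedFlow_zero [MeasurableSpace (TangentBundle I M)]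
    (μ : Measure (TangentBundle I M)) :
    IsInvariantUnderLiftedFlow (I := I) (fun _ : M ↦ (0 : E)) μ := by
  refine ⟨fun _ ↦ id, fun _ ↦ rfl, fun x t ↦ ?_, fun _ ↦ contMDiff_id, fun _ ↦ ?_⟩
  · refine (hasMFDerivAt_const (I := 𝓘(ℝ, ℝ)) (I' := I) x t).congr_mfderiv ?_
    ext
    change (0 : E) = ((1 : ℝ →L[ℝ] ℝ) (1 : ℝ)) • (0 : E)
    simp
  · rw [tangentMap_id, Measure.map_id]

end Test

/-! ### Measure solutions of the massless Vlasov equation; stationarity -/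

namespace LorentzianMetric

variable [FiniteDimensional ℝ E] (g : LorentzianMetric I n M) (τ : TimeOrientation g)
  [g.HasLeviCivita]

/-- **Measure solutions of the massless Vlasov equation** on the time-oriented Lorentzian manifold
`(M, g, τ)` (Huneau–Luk, Def. 2.1, transplanted from `T*M` to `TM` by the musical isomorphism and
restricted to the future half of the null cone): a non-negative Radon measure `μ` on the tangent
bundle `TM` which is carried by the future null bundle `P⁺` (`μ(TM ∖ P⁺) = 0`: massless,
future-directed momenta) and is invariant under the geodesic flow of `g` in the distributional
sense — for every test observable `a` (`IsTestObservable`) the Liouville derivative `X a`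
(`geodesicDeriv` for the Levi-Civita connection) is `μ`-integrable with `∫ X a dμ = 0`. For
`μ = f dμ_{P⁺}` with `f ∈ C¹` this is the massless Vlasov equation
`vᵅ ∂ₐ f − Γⁱ_{αβ} vᵅ vᵝ ∂_{vⁱ} f = 0` (Huneau–Luk, Prop. 2.2; Andréasson 2011, §2).
[cite: HuneauLuk2024trilinear, Def. 2.1 and Prop. 2.2] -/
structure IsMasslessVlasovMeasure [MeasurableSpace (TangentBundle I M)]
    (μ : Measure (TangentBundle I M)) : Prop where
  /-- The metric is at least `C¹` (so that geodesics make sense; Huneau–Luk, Def. 2.1). -/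
  one_le : (1 : ℕ∞ω) ≤ n
  /-- `μ` is a Radon measure (finite on compact sets, outer regular, inner regular on open sets). -/
  regular : μ.Regular
  /-- `μ` is carried by the future null bundle: massless, future-directed momenta. -/
  measure_compl_futureNullBundle : μ τ.futureNullBundleᶜ = 0
  /-- The Liouville derivative of a test observable is integrable … -/
  integrable_geodesicDeriv : ∀ a, IsTestObservable I M a →
    Integrable (geodesicDeriv g.leviCivita a) μ
  /-- … and integrates to zero: `μ` is invariant under the geodesic flow (Vlasov equation). -/
  integral_geodesicDeriv_eq_zero : ∀ a, IsTestObservable I M a →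
    ∫ p, geodesicDeriv g.leviCivita a p ∂μ = 0

/-- The zero measure (vacuum, no particles) is a measure solution of the massless Vlasov equation.
[folklore] -/
lemma IsMasslessVlasovMeasure.zero [MeasurableSpace (TangentBundle I M)] (hn : (1 : ℕ∞ω) ≤ n) :
    g.IsMasslessVlasovMeasure τ (0 : Measure (TangentBundle I M)) where
  one_le := hn
  regular := inferInstance
  measure_compl_futureNullBundle := rfl
  integrable_geodesicDeriv _ _ := integrable_zero_measure
  integral_geodesicDeriv_eq_zero _ _ := by simp

/-- A measure `μ` on `TM` (meant: a massless Vlasov measure) is **stationary** with respect to the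
vector field `K` and the region `Mext ⊆ M`: `K` is a stationary Killing field of `(M, g, τ)` —
Killing, complete, future-directed timelike on `Mext` (`IsStationaryKilling`; Chruściel–Costa
2008, §2.1) — and `μ` is invariant under the lifted flow of `K` (`IsInvariantUnderLiftedFlow`).
For a smooth density `f` this is `𝓛_{K̂} f = 0` for the complete lift `K̂` of `K` to `TM`, the
usual notion of a stationary (steady) state of the Einstein–Vlasov system (Andréasson 2011, §5).
[folklore] -/
def IsStationaryVlasovMeasure [MeasurableSpace (TangentBundle I M)]
    (K : Π x : M, TangentSpace I x) (Mext : Set M) (μ : Measure (TangentBundle I M)) : Prop :=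
  g.IsStationaryKilling τ K Mext ∧ IsInvariantUnderLiftedFlow K μ

end LorentzianMetric

/-! ### The volume measure and the Einstein coupling (model `EuclideanSpace ℝ (Fin m)`) -/

section Euclidean

variable {m : ℕ} {H' : Type*} [TopologicalSpace H']
  {J : ModelWithCorners ℝ (EuclideanSpace ℝ (Fin m)) H'}
  {N : Type*} [TopologicalSpace N] [ChartedSpace H' N] [IsManifold J ∞ N] {n' : ℕ∞ω}

namespace PseudoRiemannianMetric

variable (g : PseudoRiemannianMetric J n' (EuclideanSpace ℝ (Fin m)) (TangentSpace J : N → Type _))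

/-- The **Gram matrix of a pseudo-Riemannian metric in a chart**: for `N` modelled on
`EuclideanSpace ℝ (Fin m)`, `x : N` and a point `y` of the model space, the matrix
`g_{ij}(y) = g_p(∂ᵢ, ∂ⱼ)` at `p = (extChartAt J x).symm y`, with the coordinate vectors
`∂ᵢ = D((extChartAt J x).symm)(y) eᵢ` (derivative within `range J`) — the recipe of the Riemannian
`chartGramMatrix` of `Volume.lean`. Meaningful for `y ∈ (extChartAt J x).target`. O'Neill 1983,
Ch. 3, Def. 4 ff. (`g_{ij} = g(∂ᵢ, ∂ⱼ)`). [cite: ONeill1983, Ch. 3, Def. 4 ff.] -/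
def chartGram (x : N) (y : EuclideanSpace ℝ (Fin m)) : Matrix (Fin m) (Fin m) ℝ :=
  Matrix.of fun i j ↦
    g.val ((extChartAt J x).symm y)
      (mfderivWithin 𝓘(ℝ, EuclideanSpace ℝ (Fin m)) J (extChartAt J x).symm (range J) y
        (EuclideanSpace.single i 1))
      (mfderivWithin 𝓘(ℝ, EuclideanSpace ℝ (Fin m)) J (extChartAt J x).symm (range J) y
        (EuclideanSpace.single j 1))

/-- `vol` is **the volume measure `dvol_g = √|det g_{ij}| dy¹ ⋯ dyᵐ` of the pseudo-Riemannian
metric `g`**: for every measurable subset `S` of the domain of the extended chart at `x`, `vol S`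
is the Lebesgue integral over the chart image of `S` of `√|det g_{ij}(y)|` (`chartGram`). The chart
domains cover `N`, so this determines `vol`; consistency between charts is the change of variables
formula. O'Neill 1983, Ch. 7, Lemma 19 and Lemma 20 (volume element of a semi-Riemannian manifold:
`ω(∂₁, …, ∂ₘ) = |det(g_{ij})|^{1/2}` on a coordinate domain, p. 195). The intended σ-algebra is the
Borel one. [cite: ONeill1983, Ch. 7, Lemma 19 (p. 195)] -/
def IsVolumeMeasure [MeasurableSpace N] (vol : Measure N) : Prop :=
  ∀ (x : N) ⦃S : Set N⦄, MeasurableSet S → S ⊆ (extChartAt J x).source →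
    vol S = ∫⁻ y in extChartAt J x '' S, ENNReal.ofReal (Real.sqrt |(g.chartGram x y).det|)

end PseudoRiemannianMetric

namespace LorentzianMetric

variable (g : LorentzianMetric J n' N) (τ : TimeOrientation g) [g.HasLeviCivita]

/-- **Measure solutions of the Einstein–massless Vlasov system** (Huneau–Luk, Def. 2.3, in `TM`
form): `vol` is the volume measure of `g`, `μ` is a measure solution of the massless Vlasov
equation on `(N, g, τ)` (`IsMasslessVlasovMeasure`), and the Einstein equations hold with the
energy–momentum tensor of `μ` as source, in the integrated form
`∫_N Ric(Y, Y) dvol_g = ∫_{TM} g(v, Y)² dμ(x, v)` for every test vector field `Y`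
(`IsTestVectorField`; both sides integrable; polarisation and the symmetry of `Ric` give the
bilinear version). Since `μ` lives on null vectors its energy–momentum tensor
`T[μ] = ∫ v♭ ⊗ v♭ dμ` is trace-free, so the scalar curvature vanishes and `Ric = T[μ]` IS the
Einstein equation `Ric − ½ R g = T[μ]` (`8π` absorbed into `μ`; with Andréasson's
`G_{ab} = 8π T_{ab}`, `μ = 8π f dμ_{P}`). For `g ∈ C²` this forces the second-moment measure of
`μ` to be absolutely continuous in `x`; thin null shells (Lipschitz metrics) are not covered, as in
the source. [cite: HuneauLuk2024trilinear, Def. 2.3] -/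
structure IsEinsteinMasslessVlasov [MeasurableSpace N] [MeasurableSpace (TangentBundle J N)]
    (vol : Measure N) (μ : Measure (TangentBundle J N)) : Prop where
  /-- The metric is at least `C²` (so that its Ricci tensor makes sense; Huneau–Luk, Def. 2.3). -/
  two_le : (2 : ℕ∞ω) ≤ n'
  /-- `vol` is the Lorentzian volume measure `√|det g| dx` of `g`. -/
  isVolumeMeasure : g.IsVolumeMeasure vol
  /-- `μ` solves the massless Vlasov equation (Radon, carried by `P⁺`, geodesic-flow invariant). -/
  isMasslessVlasovMeasure : g.IsMasslessVlasovMeasure τ μ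
  /-- `Ric(Y, Y)` is `vol`-integrable for every test vector field `Y` … -/
  integrable_ricci : ∀ Y, IsTestVectorField Y → Integrable (fun x ↦ g.ricci x (Y x) (Y x)) vol
  /-- … the second moment `g(v, Y)²` is `μ`-integrable … -/
  integrable_sq : ∀ Y, IsTestVectorField Y →
    Integrable (fun p : TangentBundle J N ↦ (g.val p.proj p.snd (Y p.proj)) ^ 2) μ
  /-- … and the Einstein equation `Ric = T[μ]` holds, tested against `Y ⊗ Y`. -/
  integral_ricci_eq : ∀ Y, IsTestVectorField Y →
    ∫ x, g.ricci x (Y x) (Y x) ∂vol = ∫ p, (g.val p.proj p.snd (Y p.proj)) ^ 2 ∂μ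

variable {g τ}

/-- For the vacuum measure `μ = 0`, a measure solution of the Einstein–massless Vlasov system has
`∫ Ric(Y, Y) dvol_g = 0` for every test vector field `Y` (integrated vacuum equations).
[folklore] -/
lemma IsEinsteinMasslessVlasov.integral_ricci_eq_zero [MeasurableSpace N]
    [MeasurableSpace (TangentBundle J N)] {vol : Measure N}
    (h : g.IsEinsteinMasslessVlasov τ vol 0) {Y : Π x : N, TangentSpace J x}
    (hY : IsTestVectorField Y) : ∫ x, g.ricci x (Y x) (Y x) ∂vol = 0 := by
  rw [h.integral_ricci_eq Y hY, integral_zero_measure]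

end LorentzianMetric

end Euclidean

/-! ### Bundled form on a spacetime -/

namespace Spacetime

variable {d : ℕ} (𝓢 : Spacetime.{u} d)

/-- An **Einstein–massless Vlasov solution on the spacetime `𝓢`** (bundled form of
`LorentzianMetric.IsEinsteinMasslessVlasov` for the metric and time orientation of `𝓢`): the
Lorentzian volume measure `vol` of `𝓢` and a Radon measure `measure` on the tangent bundle,
carried by the future null bundle and invariant under the geodesic flow (massless Vlasov equation),
with `Ric(g) = T[measure]` in the integrated sense. The σ-algebras on `𝓢.carrier` and on its
tangent bundle are the Borel ones (instance hypotheses, as for `riemannianVolume`).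
[cite: HuneauLuk2024trilinear, Def. 2.3] -/
structure EinsteinMasslessVlasov [𝓢.metric.HasLeviCivita] [MeasurableSpace 𝓢.carrier]
    [BorelSpace 𝓢.carrier] [MeasurableSpace (TangentBundle (𝓡 d) 𝓢.carrier)]
    [BorelSpace (TangentBundle (𝓡 d) 𝓢.carrier)] where
  /-- The Lorentzian volume measure of `𝓢`. -/
  vol : Measure 𝓢.carrier
  /-- The distribution of massless particles: a measure on the tangent bundle. -/
  measure : Measure (TangentBundle (𝓡 d) 𝓢.carrier)
  /-- `(g, vol, measure)` is a measure solution of the Einstein–massless Vlasov system. -/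
  isEinsteinMasslessVlasov : 𝓢.metric.IsEinsteinMasslessVlasov 𝓢.timeOrientation vol measure

namespace EinsteinMasslessVlasov

variable {𝓢} [𝓢.metric.HasLeviCivita] [MeasurableSpace 𝓢.carrier] [BorelSpace 𝓢.carrier]
  [MeasurableSpace (TangentBundle (𝓡 d) 𝓢.carrier)] [BorelSpace (TangentBundle (𝓡 d) 𝓢.carrier)]

/-- The solution `S` is **stationary** with respect to the Killing field `K` and the asymptotic
region `Mext`: `K` is a complete Killing field, future-directed timelike on `Mext`, whose lifted
flow preserves the particle measure (`LorentzianMetric.IsStationaryVlasovMeasure`). [folklore] -/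
def IsStationary (S : 𝓢.EinsteinMasslessVlasov) (K : Π x : 𝓢.carrier, TangentSpace (𝓡 d) x)
    (Mext : Set 𝓢.carrier) : Prop :=
  𝓢.metric.IsStationaryVlasovMeasure 𝓢.timeOrientation K Mext S.measure

/-- The solution `S` is **vacuum**: there are no particles, `S.measure = 0`. [folklore] -/
def IsVacuum (S : 𝓢.EinsteinMasslessVlasov) : Prop :=
  S.measure = 0

/-- A vacuum Einstein–massless Vlasov solution satisfies the integrated vacuum equations
`∫ Ric(Y, Y) dvol = 0`. [folklore] -/
lemma IsVacuum.integral_ricci_eq_zero {S : 𝓢.EinsteinMasslessVlasov} (h : S.IsVacuum)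
    {Y : Π x : 𝓢.carrier, TangentSpace (𝓡 d) x} (hY : IsTestVectorField Y) :
    ∫ x, 𝓢.metric.ricci x (Y x) (Y x) ∂S.vol = 0 := by
  have h' := S.isEinsteinMasslessVlasov
  rw [show S.measure = 0 from h] at h'
  exact h'.integral_ricci_eq_zero hY

end EinsteinMasslessVlasov

end Spacetime

end Literature.Geometry.Lorentzian

end
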